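import Literature.NumberTheory.GaloisRepresentations.IdelicLocalNorm
import Literature.NumberTheory.GaloisRepresentations.HeckeCharacterArchTypeProofs
import Literature.NumberTheory.GaloisRepresentations.HeckeCharacterAutConj
import Literature.NumberTheory.GaloisRepresentations.HeckeCharacterNormTwistProofs
import Literature.NumberTheory.GaloisRepresentations.HeckeCharacterNormCharacter
import Literature.NumberTheory.GaloisRepresentations.PadicEmbeddingCompletion
import Mathlib.NumberTheory.NumberField.CMField
import HarnessLib

/-!
# Algebraic Hecke characters of CM type on a CM field (Weil 1956; Clozel–Harris–Taylor 2008,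
# Lemmas 4.1.4–4.1.5, the Hecke-character half)

Topic `NumberTheory/GaloisRepresentations`; namespace
`Literature.NumberTheory.GaloisRepresentations.HeckeCharacter`.  Proof file (theorems and small
definitions with bodies; no named fact, no instance, D-0026), the Hecke side of the proof of the
named fact `ClozelHarrisTaylor2008.exists_cm_character_sq_eq_cyclotomic_pow`
(`CMCharacterCyclotomicSquareRoot`): on a CM field `F` with complex conjugation `c` and a "CM type
of places" `Φ` above `ℓ`, an algebraic Hecke character `Ξ` with

* `Ξ · (Ξ ∘ c) = ‖·‖^{-2M}` EXACTLY (values: `Ξ(ϖ_v) Ξ(ϖ_{c v}) = q_v^{2M}`... see `valueAtUniformizer_cmTwist_mul`),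
* all embedding exponents above `Φᶜ` equal to `0`, and all exponents of `Ξ ‖·‖^{2M}` above `Φ` equal
  to `0`,
* unramified away from two auxiliary conjugate primes.

Contents.
* §1 `HeckeCharacter.galConj σ χ = χ ∘ (σ • ·)` for `σ ∈ Aut(K/F₀)` acting on ideles
  (`Automorphic/GaloisActionAdeleRing`, `ClassFieldCharacter`): unramifiedness and values at
  uniformisers are transported along `v ↦ σ • v` (`algEquiv_smul_localUnits`).
* §2 Algebra of infinity types: `HasInfinityType.mul'/inv/zpow'`, the type `(-1, -1)` of `‖·‖`, and
  **the type `(q, p)` of `χ ∘ c`** for the complex conjugation `c` of a CM field (`c` fixes every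
  infinite place and `ι_w ∘ c_w = conj ∘ ι_w` on `K_w`).
* §3 The CM type `T_Φ = {φ : K → ℂ | place(ι⁻¹ ∘ φ) ∈ Φ}` of a CM type of places, its exponent
  function and infinity type.
* §4 **Existence** (Weil 1956 §1; CHT Lemma 4.1.4): a unitary Hecke character `χ₀` with unitary
  archimedean type `((u/|u|)^{m_w})_w`, `m_w = ±2k` according to `T_Φ`, trivial on the congruence
  unit ideles of level `𝔞 = 𝔭 · c𝔭` for a prime `𝔭 ∤ ℓ` separating the roots of unity — the unit
  obstruction vanishes because a unit `u ≡ 1 (mod 𝔞)` has `u / c u ∈ μ(F)` (Kronecker, Mathlib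
  `IsCMField.unitsMulComplexConjInv`) `≡ 1 (mod 𝔭)`, hence `u = c u` is real and the exponents
  are even; then `χ' = χ₀ ‖·‖^{k}` is algebraic of type `-2k · 1_{T_Φ}`.
* §5 `Ξ = ‖·‖^{2k} χ' (χ' ∘ c)⁻¹` and its three properties above.

Import hygiene.  A handful of two-to-ten-line folklore lemmas (primed names:
`ideleNorm_infiniteIdeles'`, `isUnramifiedAt_normCharacter'`, `norm_uniformizer'`,
`valueAtUniformizer_mul'/inv'/zpow'`, `zpow_apply'`, `smul_principalIdele'`, `HasInfinityType.mul'`,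
`infinite_heightOneSpectrum''`, `finite_setOf_mem_asIdeal`, `localUnits_mem_unitIdeles`) have
near-duplicates in `WeakAbelianDirectSummandCyclotomicProofs`, `HeckeLFunction*Proofs`,
`PAdicHodge/DeRhamInducedRepresentationWeightsProofs`, `SorensenPatching`,
`QuadraticForms/HilbertReciprocityFiniteness`, `AdmissibleModulusGalois` or in `Summits/` files; they
are re-proved here on purpose, so that this file (and the CHT 4.1.6 proof importing it) does not pull
Iwasawa theory, `p`-adic Hodge theory, Hecke `L`-function analysis or patching into its import closure
(and Literature may not import Summits).

## References

* A. Weil, *On a certain type of characters of the idèle-class group of an algebraic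
  number-field*, Proc. Int. Symp. Tokyo–Nikko 1955 (1956), 1–7, §1. [Weil1956]
* L. Clozel, M. Harris, R. Taylor, *Automorphy for some ℓ-adic lifts of automorphic mod ℓ Galois
  representations*, Publ. Math. IHÉS 108 (2008), Lemmas 4.1.1, 4.1.4, 4.1.5 (pp. 116–120).
  [ClozelHarrisTaylor2008]
* J.-P. Serre, *Abelian ℓ-adic representations and elliptic curves* (1968), Ch. II §2.4, §3.1.
  [SerreAbelianLadic1968]
-/

noncomputable section

open scoped NumberField Topology ComplexConjugate Pointwise
open NumberField IsDedekindDomain Filter NumberField.InfinitePlace NumberField.InfinitePlace.Completion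
open Literature.NumberTheory.Automorphic

namespace Literature.NumberTheory.GaloisRepresentations

namespace HeckeCharacter

/-! ### §1. Small API and the conjugate `χ ∘ σ` of a Hecke character by a field automorphism -/

section General

variable {F₀ K : Type} [Field F₀] [Field K] [NumberField K] [Algebra F₀ K]

/-- Integral powers of Hecke characters are pointwise. [folklore] -/
@[simp] theorem zpow_apply' (χ : HeckeCharacter K) (n : ℤ) (x : ideleGroup K) : (χ ^ n) x = χ x ^ n := by
  cases n with
  | ofNat n => rw [Int.ofNat_eq_natCast, zpow_natCast, zpow_natCast, pow_apply]
  | negSucc n => rw [zpow_negSucc, zpow_negSucc, inv_apply, pow_apply]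

/-- A unit of `𝒪_v` has valuation `1`. [folklore] -/
theorem valued_coe_units_adicCompletionIntegers (v : HeightOneSpectrum (𝓞 K))
    (u : (v.adicCompletionIntegers K)ˣ) :
    Valued.v ((u : v.adicCompletionIntegers K) : v.adicCompletion K) = 1 := by
  have h1 : Valued.v ((u : v.adicCompletionIntegers K) : v.adicCompletion K) ≤ 1 :=
    (u : v.adicCompletionIntegers K).2
  have h2 : Valued.v (((u⁻¹ : (v.adicCompletionIntegers K)ˣ) : v.adicCompletionIntegers K) : v.adicCompletion K) ≤ 1 :=
    ((u⁻¹ : (v.adicCompletionIntegers K)ˣ) : v.adicCompletionIntegers K).2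
  have hmul : Valued.v ((u : v.adicCompletionIntegers K) : v.adicCompletion K) *
      Valued.v (((u⁻¹ : (v.adicCompletionIntegers K)ˣ) : v.adicCompletionIntegers K) : v.adicCompletion K) = 1 := by
    rw [← map_mul, ← MulMemClass.coe_mul, Units.mul_inv, OneMemClass.coe_one, map_one]
  refine le_antisymm h1 ?_
  calc (1 : WithZero (Multiplicative ℤ))
      = Valued.v ((u : v.adicCompletionIntegers K) : v.adicCompletion K) *
        Valued.v (((u⁻¹ : (v.adicCompletionIntegers K)ˣ) : v.adicCompletionIntegers K) : v.adicCompletion K) := hmul.symm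
    _ ≤ Valued.v ((u : v.adicCompletionIntegers K) : v.adicCompletion K) * 1 := mul_le_mul_right h2 _
    _ = _ := mul_one _

/-- `χ` is unramified at `v` iff `χ(⟨w⟩_v) = 1` for every `w ∈ K_vˣ` of valuation `1`. [folklore] -/
theorem isUnramifiedAt_iff_forall_valued_eq_one {χ : HeckeCharacter K} {v : HeightOneSpectrum (𝓞 K)} :
    χ.IsUnramifiedAt v ↔
      ∀ w : (v.adicCompletion K)ˣ, Valued.v (w : v.adicCompletion K) = 1 → χ (localUnits v w) = 1 := by
  constructor
  · intro h w hw
    have hw' : Valued.v ((w⁻¹ : (v.adicCompletion K)ˣ) : v.adicCompletion K) = 1 := by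
      rw [Units.val_inv_eq_inv_val, map_inv₀, hw, inv_one]
    let u : (v.adicCompletionIntegers K)ˣ :=
      ⟨⟨(w : v.adicCompletion K), hw.le⟩, ⟨((w⁻¹ : (v.adicCompletion K)ˣ) : v.adicCompletion K), hw'.le⟩,
        Subtype.ext w.mul_inv, Subtype.ext w.inv_mul⟩
    have hmap : Units.map ((v.adicCompletionIntegers K).subtype : _ →* _) u = w := Units.ext rfl
    have := h u
    rwa [hmap, localComponent_apply] at this
  · intro h u
    rw [localComponent_apply]
    exact h _ (valued_coe_units_adicCompletionIntegers v u)

/-- Unramifiedness is multiplicative. [folklore] -/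
theorem IsUnramifiedAt.mul' {χ ψ : HeckeCharacter K} {v : HeightOneSpectrum (𝓞 K)} (hχ : χ.IsUnramifiedAt v)
    (hψ : ψ.IsUnramifiedAt v) : (χ * ψ).IsUnramifiedAt v := by
  rw [isUnramifiedAt_iff_forall_valued_eq_one] at hχ hψ ⊢
  intro w hw
  rw [mul_apply, hχ w hw, hψ w hw, mul_one]

/-- Unramifiedness passes to inverses. [folklore] -/
theorem IsUnramifiedAt.inv' {χ : HeckeCharacter K} {v : HeightOneSpectrum (𝓞 K)} (hχ : χ.IsUnramifiedAt v) :
    χ⁻¹.IsUnramifiedAt v := by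
  rw [isUnramifiedAt_iff_forall_valued_eq_one] at hχ ⊢
  intro w hw
  rw [inv_apply, hχ w hw, inv_one]

/-- Unramifiedness passes to integral powers. [folklore] -/
theorem IsUnramifiedAt.zpow' {χ : HeckeCharacter K} {v : HeightOneSpectrum (𝓞 K)} (hχ : χ.IsUnramifiedAt v)
    (n : ℤ) : (χ ^ n).IsUnramifiedAt v := by
  rw [isUnramifiedAt_iff_forall_valued_eq_one] at hχ ⊢
  intro w hw
  rw [zpow_apply', hχ w hw, one_zpow]

/-- Values at uniformisers are multiplicative at unramified places. [folklore] -/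
theorem valueAtUniformizer_mul' (χ ψ : HeckeCharacter K) (v : HeightOneSpectrum (𝓞 K)) :
    (χ * ψ).valueAtUniformizer v = χ.valueAtUniformizer v * ψ.valueAtUniformizer v := by
  simp only [valueAtUniformizer, localComponent_apply, mul_apply, Units.val_mul]

/-- Values at uniformisers of the inverse. [folklore] -/
theorem valueAtUniformizer_inv' (χ : HeckeCharacter K) (v : HeightOneSpectrum (𝓞 K)) :
    χ⁻¹.valueAtUniformizer v = (χ.valueAtUniformizer v)⁻¹ := by
  simp only [valueAtUniformizer, localComponent_apply, inv_apply, Units.val_inv_eq_inv_val]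

/-- Values at uniformisers of integral powers. [folklore] -/
theorem valueAtUniformizer_zpow' (χ : HeckeCharacter K) (n : ℤ) (v : HeightOneSpectrum (𝓞 K)) :
    (χ ^ n).valueAtUniformizer v = χ.valueAtUniformizer v ^ n := by
  simp only [valueAtUniformizer, localComponent_apply, zpow_apply', Units.val_zpow_eq_zpow_val]

/-- The action of `σ ∈ Aut(K/F₀)` on the idele group is continuous. [folklore] -/
theorem continuous_smul_ideleGroup (σ : K ≃ₐ[F₀] K) : Continuous fun x : ideleGroup K => σ • x := by
  refine Units.continuous_iff.2 ⟨?_, ?_⟩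
  · change Continuous fun x : ideleGroup K => ((σ • x : ideleGroup K) : AdeleRing (𝓞 K) K)
    simp_rw [AdeleRing.coe_smul_units]
    exact (AdeleRing.continuous_smul F₀ σ).comp Units.continuous_val
  · change Continuous fun x : ideleGroup K => (((σ • x)⁻¹ : ideleGroup K) : AdeleRing (𝓞 K) K)
    simp_rw [← smul_inv', AdeleRing.coe_smul_units]
    exact (AdeleRing.continuous_smul F₀ σ).comp Units.continuous_coe_inv

/-- `σ • (k) = (σ k)` for principal ideles. [folklore] -/
theorem smul_principalIdele' (σ : K ≃ₐ[F₀] K) (k : Kˣ) :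
    σ • principalIdele K k = principalIdele K (Units.map (σ : K →+* K).toMonoidHom k) := by
  apply Units.ext
  rw [AdeleRing.coe_smul_units]
  change σ • algebraMap K (AdeleRing (𝓞 K) K) (k : K) = algebraMap K (AdeleRing (𝓞 K) K) (σ (k : K))
  rw [AdeleRing.smul_algebraMap]

/-- **The conjugate `χ ∘ σ` of a Hecke character** by `σ ∈ Aut(K/F₀)`: `x ↦ χ(σ • x)` (`σ` acting on
the ideles through the adele ring).  It is again a Hecke character: continuous, and trivial on `Kˣ`
because `σ • (k) = (σ k)`.  (CHT 2008 write `χ^c`, `ψ ∘ N_{F/F⁺}`, Lemma 4.1.4.) [folklore] -/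
def galConj (σ : K ≃ₐ[F₀] K) (χ : HeckeCharacter K) : HeckeCharacter K where
  toContinuousMonoidHom :=
    ⟨χ.toContinuousMonoidHom.toMonoidHom.comp (MulDistribMulAction.toMonoidHom (ideleGroup K) σ), by
      change Continuous fun x : ideleGroup K => χ (σ • x)
      exact (map_continuous χ).comp (continuous_smul_ideleGroup σ)⟩
  map_principal' x hx := by
    obtain ⟨k, rfl⟩ := hx
    change χ (σ • principalIdele K k) = 1
    rw [smul_principalIdele' σ k]
    exact χ.map_principal (principalIdele_mem _)

/-- `(χ ∘ σ)(x) = χ(σ • x)`. [folklore] -/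
@[simp] theorem galConj_apply (σ : K ≃ₐ[F₀] K) (χ : HeckeCharacter K) (x : ideleGroup K) :
    galConj σ χ x = χ (σ • x) := rfl

/-- **Transport of unramifiedness**: `χ ∘ σ` is unramified at `v` iff `χ` is unramified at `σ • v`
(`σ • ⟨w⟩_v = ⟨σ w⟩_{σ v}`, and `σ : K_vˣ → K_{σ v}ˣ` preserves valuations). [folklore] -/
theorem isUnramifiedAt_galConj_iff (σ : K ≃ₐ[F₀] K) (χ : HeckeCharacter K) (v : HeightOneSpectrum (𝓞 K)) :
    (galConj σ χ).IsUnramifiedAt v ↔ χ.IsUnramifiedAt (σ • v) := by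
  rw [isUnramifiedAt_iff_forall_valued_eq_one, isUnramifiedAt_iff_forall_valued_eq_one]
  constructor
  · intro h w hw
    set w₀ := (galAdicCompletionUnitsEquiv (L := K) σ (rfl : σ • v = σ • v)).symm w with hw₀
    have hww : galAdicCompletionUnitsEquiv (L := K) σ (rfl : σ • v = σ • v) w₀ = w := by
      rw [hw₀, MulEquiv.apply_symm_apply]
    have hv₀ : Valued.v (w₀ : v.adicCompletion K) = 1 := by
      rw [← valued_galAdicCompletionUnitsEquiv K σ rfl w₀, hww]; exact hw
    have := h w₀ hv₀
    rwa [galConj_apply, algEquiv_smul_localUnits, hww] at this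
  · intro h w hw
    rw [galConj_apply, algEquiv_smul_localUnits]
    exact h _ (by rw [valued_galAdicCompletionUnitsEquiv]; exact hw)

/-- **Transport of the values at uniformisers**: if `χ` is unramified at `σ • v` then
`(χ ∘ σ)(ϖ_v) = χ(ϖ_{σ v})` (the transported uniformiser is a uniformiser). [folklore] -/
theorem valueAtUniformizer_galConj_of_isUnramifiedAt (σ : K ≃ₐ[F₀] K) (χ : HeckeCharacter K) (v : HeightOneSpectrum (𝓞 K))
    (h : χ.IsUnramifiedAt (σ • v)) :
    (galConj σ χ).valueAtUniformizer v = χ.valueAtUniformizer (σ • v) := by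
  rw [valueAtUniformizer, localComponent_apply, galConj_apply, algEquiv_smul_localUnits,
    ← localComponent_apply]
  exact localComponent_eq_valueAtUniformizer h (by rw [valued_galAdicCompletionUnitsEquiv, valued_uniformizer])

/-- `galConj` is multiplicative in `χ`. [folklore] -/
theorem galConj_mul (σ : K ≃ₐ[F₀] K) (χ ψ : HeckeCharacter K) :
    galConj σ (χ * ψ) = galConj σ χ * galConj σ ψ := by
  ext x; rfl

/-- `galConj` of the inverse. [folklore] -/
theorem galConj_inv (σ : K ≃ₐ[F₀] K) (χ : HeckeCharacter K) : galConj σ χ⁻¹ = (galConj σ χ)⁻¹ := by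
  ext x; rfl

/-- `galConj` along a product of automorphisms. [folklore] -/
theorem galConj_galConj (σ τ : K ≃ₐ[F₀] K) (χ : HeckeCharacter K) :
    galConj σ (galConj τ χ) = galConj (τ * σ) χ := by
  ext x
  simp only [galConj_apply, mul_smul]

/-- `galConj 1 = id`. [folklore] -/
theorem galConj_one (χ : HeckeCharacter K) : galConj (1 : K ≃ₐ[F₀] K) χ = χ := by
  ext x
  simp only [galConj_apply, one_smul]

end General

/-! ### §2. Algebra of infinity types -/

section InfinityType

variable {K : Type} [Field K] [NumberField K]

/-- `A_{p+p',q+q'} = A_{p,q} A_{p',q'}`. [folklore] -/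
theorem archFactor_add (p q p' q' : InfinitePlace K → ℤ) (x : (InfiniteAdeleRing K)ˣ) :
    archFactor (p + p') (q + q') x = archFactor p q x * archFactor p' q' x := by
  rw [archFactor_apply, archFactor_apply, archFactor_apply, ← Finset.prod_mul_distrib]
  refine Finset.prod_congr rfl fun w _ => ?_
  have hE := InfiniteIdele.extensionEmbedding_apply_ne_zero x w
  rw [Pi.add_apply, Pi.add_apply, neg_add, neg_add, zpow_add₀ hE, zpow_add₀ ((map_ne_zero _).2 hE)]
  ring

/-- `A_{-p,-q} = A_{p,q}⁻¹`. [folklore] -/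
theorem archFactor_neg (p q : InfinitePlace K → ℤ) (x : (InfiniteAdeleRing K)ˣ) :
    archFactor (-p) (-q) x = (archFactor p q x)⁻¹ := by
  rw [archFactor_apply, archFactor_apply, ← Finset.prod_inv_distrib]
  refine Finset.prod_congr rfl fun w _ => ?_
  rw [Pi.neg_apply, Pi.neg_apply, mul_inv, ← zpow_neg, ← zpow_neg]

/-- `A_{n p, n q} = A_{p,q}^n`. [folklore] -/
theorem archFactor_zsmul (n : ℤ) (p q : InfinitePlace K → ℤ) (x : (InfiniteAdeleRing K)ˣ) :
    archFactor (n • p) (n • q) x = archFactor p q x ^ n := by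
  rw [archFactor_apply, archFactor_apply, ← Finset.prod_zpow]
  refine Finset.prod_congr rfl fun w _ => ?_
  rw [Pi.smul_apply, Pi.smul_apply, smul_eq_mul, smul_eq_mul, mul_zpow, ← zpow_mul, ← zpow_mul]
  congr 1 <;> congr 1 <;> ring

/-- **Infinity types multiply.** [folklore] -/
theorem HasInfinityType.mul' {χ ψ : HeckeCharacter K} {p q p' q' : InfinitePlace K → ℤ}
    (hχ : χ.HasInfinityType p q) (hψ : ψ.HasInfinityType p' q') :
    (χ * ψ).HasInfinityType (p + p') (q + q') := by
  obtain ⟨U, hU, h⟩ := hχ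
  obtain ⟨U', hU', h'⟩ := hψ
  refine ⟨U ∩ U', inter_mem hU hU', fun x hx => ?_⟩
  rw [mul_apply, Units.val_mul, h x hx.1, h' x hx.2, archFactor_add]

/-- Infinity type of the inverse. [folklore] -/
theorem HasInfinityType.inv {χ : HeckeCharacter K} {p q : InfinitePlace K → ℤ} (hχ : χ.HasInfinityType p q) :
    χ⁻¹.HasInfinityType (-p) (-q) := by
  obtain ⟨U, hU, h⟩ := hχ
  refine ⟨U, hU, fun x hx => ?_⟩
  rw [inv_apply, Units.val_inv_eq_inv_val, h x hx, archFactor_neg]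

/-- Infinity type of an integral power. [folklore] -/
theorem HasInfinityType.zpow' {χ : HeckeCharacter K} {p q : InfinitePlace K → ℤ} (hχ : χ.HasInfinityType p q)
    (n : ℤ) : (χ ^ n).HasInfinityType (n • p) (n • q) := by
  obtain ⟨U, hU, h⟩ := hχ
  refine ⟨U, hU, fun x hx => ?_⟩
  rw [zpow_apply', Units.val_zpow_eq_zpow_val, h x hx, archFactor_zsmul]

/-- The idele norm of an infinite idele `(x, 1)` is its archimedean part
`∏_{w ∣ ∞} ‖x_w‖^{[K_w : ℝ]}` (cf. `WeakAbelianDirectSummandCyclotomicProofs`). [folklore] -/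
theorem ideleNorm_infiniteIdeles' (x : (InfiniteAdeleRing K)ˣ) :
    ideleNorm (infiniteIdeles K x) = ∏ w : InfinitePlace K, ‖(x : InfiniteAdeleRing K) w‖ ^ w.mult := by
  unfold ideleNorm
  have h2 : ((infiniteIdeles K x : ideleGroup K) : AdeleRing (𝓞 K) K).2 = 1 := rfl
  have h3 : ∀ v : HeightOneSpectrum (𝓞 K), (1 : FiniteAdeleRing (𝓞 K) K) v = 1 := fun v => rfl
  rw [h2, infiniteIdeles_fst, finprod_eq_one_of_forall_eq_one fun v => by rw [h3 v, norm_one], mul_one]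

/-- **The norm character has infinity type `(-1, -1)`** at the complex places (`(-1, 0)` at the
real ones): `‖(x,1)‖ = ∏_{w real} ι_w(x_w) ∏_{w complex} ι_w(x_w) \overline{ι_w(x_w)}` for `x` with
positive real coordinates (cf. `isAlgebraic_normCharacter`).  Serre 1968, Ch. II §2.3.
[cite: SerreAbelianLadic1968, Ch. II §2.3] -/
theorem hasInfinityType_normCharacter' [DecidablePred fun w : InfinitePlace K => w.IsReal] :
    (normCharacter K).HasInfinityType (fun _ => -1) (fun w => if w.IsReal then 0 else -1) := by
  set E : InfinitePlace K → (InfiniteAdeleRing K)ˣ → ℂ := fun w x =>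
    extensionEmbedding w ((x : InfiniteAdeleRing K) w) with hE
  have hEcont : ∀ w, Continuous (E w) := fun w =>
    (isometry_extensionEmbedding w).continuous.comp ((continuous_apply w).comp Units.continuous_val)
  have hEnorm : ∀ w x, ‖E w x‖ = ‖(x : InfiniteAdeleRing K) w‖ := fun w x =>
    (isometry_extensionEmbedding w).norm_map_of_map_zero (map_zero _) _
  set U : Set (InfiniteAdeleRing K)ˣ := {x | ∀ w : InfinitePlace K, w.IsReal → 0 < (E w x).re} with hU
  have hUopen : IsOpen U := by
    have : U = ⋂ w : InfinitePlace K, {x | w.IsReal → 0 < (E w x).re} := by ext x; simp [hU]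
    rw [this]
    refine isOpen_iInter_of_finite fun w => ?_
    by_cases hw : w.IsReal
    · have : {x : (InfiniteAdeleRing K)ˣ | w.IsReal → 0 < (E w x).re} = (fun x => (E w x).re) ⁻¹' Set.Ioi 0 := by
        ext x; simp [hw]
      rw [this]
      exact isOpen_Ioi.preimage (Complex.continuous_re.comp (hEcont w))
    · have : {x : (InfiniteAdeleRing K)ˣ | w.IsReal → 0 < (E w x).re} = Set.univ := by ext x; simp [hw]
      rw [this]; exact isOpen_univ
  have hUone : (1 : (InfiniteAdeleRing K)ˣ) ∈ U := fun w _ => by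
    simp only [hE, Units.val_one]
    rw [show (1 : InfiniteAdeleRing K) w = 1 from rfl, map_one, Complex.one_re]
    exact one_pos
  refine ⟨U, hUopen.mem_nhds hUone, fun x hx => ?_⟩
  rw [normCharacter_apply, ideleNorm_infiniteIdeles', Complex.ofReal_prod, archFactor_apply]
  refine Finset.prod_congr rfl fun w _ => ?_
  change ((‖(x : InfiniteAdeleRing K) w‖ ^ w.mult : ℝ) : ℂ) =
    E w x ^ (-(-1 : ℤ)) * (starRingEnd ℂ) (E w x) ^ (-(if w.IsReal then (0 : ℤ) else -1))
  rw [Complex.ofReal_pow, ← hEnorm w x, neg_neg, zpow_one]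
  by_cases hw : w.IsReal
  · rw [NumberField.InfinitePlace.mult, if_pos hw, if_pos hw, neg_zero, zpow_zero, mul_one, pow_one]
    have hreal : ((extensionEmbeddingOfIsReal hw ((x : InfiniteAdeleRing K) w) : ℝ) : ℂ) = E w x :=
      extensionEmbeddingOfIsReal_apply hw _
    have hpos : 0 < (E w x).re := hx w hw
    rw [← hreal] at hpos ⊢
    rw [Complex.ofReal_re] at hpos
    rw [Complex.norm_real, Real.norm_eq_abs, abs_of_pos hpos]
  · rw [NumberField.InfinitePlace.mult, if_neg hw, if_neg hw, neg_neg, zpow_one, Complex.mul_conj']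

end InfinityType

/-! ### §2b. The conjugate of an algebraic Hecke character of a CM field by complex conjugation -/

section CMConj

variable {K : Type} [Field K] [NumberField K] [IsCMField K]

/-- `c² = 1` for the complex conjugation of a CM field, as an automorphism. [folklore] -/
theorem complexConj_mul_self : IsCMField.complexConj K * IsCMField.complexConj K = 1 :=
  AlgEquiv.ext fun x => IsCMField.complexConj_apply_apply K x

/-- `c⁻¹ = c`. [folklore] -/
theorem complexConj_inv : (IsCMField.complexConj K)⁻¹ = IsCMField.complexConj K :=
  inv_eq_of_mul_eq_one_right complexConj_mul_self

/-- Complex conjugation fixes every infinite place of a CM field. [folklore] -/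
theorem complexConj_smul_infinitePlace (w : InfinitePlace K) : IsCMField.complexConj K • w = w := by
  apply DFunLike.ext
  intro x
  rw [InfinitePlace.smul_apply]
  change w ((IsCMField.complexConj K)⁻¹ x) = w x
  rw [complexConj_inv, IsCMField.infinitePlace_complexConj]

/-- **`ι_w ∘ c_w = conj ∘ ι_w` on `K_w`**: the continuous extension of complex conjugation to an
archimedean completion is complex conjugation under the embedding `ι_w`. [folklore] -/
theorem extensionEmbedding_galInfiniteCompletionMap_complexConj (w : InfinitePlace K)
    (h : IsCMField.complexConj K • w = w) (y : w.Completion) :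
    extensionEmbedding w (galInfiniteCompletionMap (IsCMField.complexConj K) h y) =
      starRingEnd ℂ (extensionEmbedding w y) := by
  refine congrFun (InfinitePlace.Completion.ext_of_coe w
    ((isometry_extensionEmbedding w).continuous.comp
      (continuous_galInfiniteCompletionMap (maximalRealSubfield K) (IsCMField.complexConj K) h))
    (Complex.continuous_conj.comp (isometry_extensionEmbedding w).continuous) fun x => ?_) y
  simp only [Function.comp_apply]
  rw [galInfiniteCompletionMap_coe]
  change extensionEmbedding w ((WithAbs.toAbs w.1 (IsCMField.complexConj K x) : WithAbs w.1) : w.Completion) =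
    starRingEnd ℂ (extensionEmbedding w ((WithAbs.toAbs w.1 x : WithAbs w.1) : w.Completion))
  rw [extensionEmbedding_coe, extensionEmbedding_coe]
  exact IsCMField.complexEmbedding_complexConj K w.embedding x

/-- The action of `c` on the infinite ideles, as units. [folklore] -/
def infSMul (x : (InfiniteAdeleRing K)ˣ) : (InfiniteAdeleRing K)ˣ :=
  Units.map (MulSemiringAction.toRingHom (K ≃ₐ[maximalRealSubfield K] K) (InfiniteAdeleRing K)
    (IsCMField.complexConj K)).toMonoidHom x

/-- `infSMul x = c • x` on values. [folklore] -/
@[simp] theorem val_infSMul (x : (InfiniteAdeleRing K)ˣ) :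
    (infSMul x : InfiniteAdeleRing K) = IsCMField.complexConj K • (x : InfiniteAdeleRing K) := rfl

/-- `infSMul` is continuous. [folklore] -/
theorem continuous_infSMul : Continuous (infSMul (K := K)) :=
  Continuous.units_map _ (InfiniteAdeleRing.continuous_smul (maximalRealSubfield K) (IsCMField.complexConj K))

/-- `c • (x, 1) = (c • x, 1)`. [folklore] -/
theorem smul_infiniteIdeles (x : (InfiniteAdeleRing K)ˣ) :
    IsCMField.complexConj K • infiniteIdeles K x = infiniteIdeles K (infSMul x) := by
  apply Units.ext
  rw [AdeleRing.coe_smul_units]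
  change IsCMField.complexConj K • (((x : InfiniteAdeleRing K), (1 : FiniteAdeleRing (𝓞 K) K)) : AdeleRing (𝓞 K) K) =
    ((IsCMField.complexConj K • (x : InfiniteAdeleRing K), (1 : FiniteAdeleRing (𝓞 K) K)) : AdeleRing (𝓞 K) K)
  rw [AdeleRing.smul_mk, smul_one]

/-- The archimedean coordinates of `c • x` under `ι_w` are the conjugates of those of `x`. [folklore] -/
theorem extensionEmbedding_infSMul (x : (InfiniteAdeleRing K)ˣ) (w : InfinitePlace K) :
    extensionEmbedding w ((infSMul x : InfiniteAdeleRing K) w) =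
      starRingEnd ℂ (extensionEmbedding w ((x : InfiniteAdeleRing K) w)) := by
  rw [val_infSMul, InfiniteAdeleRing.smul_apply,
    galInfiniteCompletionMap_apply_congr_place (maximalRealSubfield K)
      (InfinitePlace.inv_smul_eq_of_smul_eq (complexConj_smul_infinitePlace w))
      (smul_inv_smul (IsCMField.complexConj K) w) (complexConj_smul_infinitePlace w)
      (fun u => (x : InfiniteAdeleRing K) u),
    extensionEmbedding_galInfiniteCompletionMap_complexConj]

/-- `A_{p,q}(c • x) = A_{q,p}(x)`. [folklore] -/
theorem archFactor_infSMul (p q : InfinitePlace K → ℤ) (x : (InfiniteAdeleRing K)ˣ) :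
    archFactor p q (infSMul x) = archFactor q p x := by
  rw [archFactor_apply, archFactor_apply]
  refine Finset.prod_congr rfl fun w _ => ?_
  rw [extensionEmbedding_infSMul, Complex.conj_conj, ← map_zpow₀, mul_comm]

/-- **The conjugate `χ ∘ c` of a Hecke character of infinity type `(p, q)` has infinity type
`(q, p)`** (CM field, `c` = complex conjugation). [folklore] -/
theorem HasInfinityType.galConj_complexConj {χ : HeckeCharacter K} {p q : InfinitePlace K → ℤ}
    (hχ : χ.HasInfinityType p q) :
    (galConj (IsCMField.complexConj K) χ).HasInfinityType q p := by
  obtain ⟨U, hU, h⟩ := hχ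
  refine ⟨infSMul ⁻¹' U, ?_, fun x hx => ?_⟩
  · refine continuous_infSMul.continuousAt.preimage_mem_nhds ?_
    rwa [show infSMul (1 : (InfiniteAdeleRing K)ˣ) = 1 from map_one _]
  · rw [galConj_apply, smul_infiniteIdeles, h _ hx, archFactor_infSMul]

end CMConj

/-! ### §3. Exponents of embeddings and the CM type `T_Φ` of a CM type of places above `ℓ` -/

section Exponents

variable {K : Type} [Field K] [NumberField K]

omit [NumberField K] in
/-- `embExponent` is additive in the type. [folklore] -/
theorem embExponent_add (p q p' q' : InfinitePlace K → ℤ) (φ : K →+* ℂ) :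
    embExponent (p + p') (q + q') φ = embExponent p q φ + embExponent p' q' φ := by
  unfold embExponent
  by_cases h1 : ComplexEmbedding.IsReal φ
  · rw [if_pos h1, if_pos h1, if_pos h1, Pi.add_apply, Pi.add_apply]; ring
  · by_cases h2 : φ = (InfinitePlace.mk φ).embedding
    · rw [if_neg h1, if_neg h1, if_neg h1, if_pos h2, if_pos h2, if_pos h2, Pi.add_apply]
    · rw [if_neg h1, if_neg h1, if_neg h1, if_neg h2, if_neg h2, if_neg h2, Pi.add_apply]

omit [NumberField K] in
/-- `embExponent` of the negated type. [folklore] -/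
theorem embExponent_neg (p q : InfinitePlace K → ℤ) (φ : K →+* ℂ) :
    embExponent (-p) (-q) φ = -embExponent p q φ := by
  unfold embExponent
  by_cases h1 : ComplexEmbedding.IsReal φ
  · rw [if_pos h1, if_pos h1, Pi.neg_apply, Pi.neg_apply]; ring
  · by_cases h2 : φ = (InfinitePlace.mk φ).embedding
    · rw [if_neg h1, if_neg h1, if_pos h2, if_pos h2, Pi.neg_apply]
    · rw [if_neg h1, if_neg h1, if_neg h2, if_neg h2, Pi.neg_apply]

omit [NumberField K] in
/-- `embExponent` of a multiple of the type. [folklore] -/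
theorem embExponent_zsmul (n : ℤ) (p q : InfinitePlace K → ℤ) (φ : K →+* ℂ) :
    embExponent (n • p) (n • q) φ = n * embExponent p q φ := by
  unfold embExponent
  by_cases h1 : ComplexEmbedding.IsReal φ
  · rw [if_pos h1, if_pos h1, Pi.smul_apply, Pi.smul_apply, smul_eq_mul, smul_eq_mul]; ring
  · by_cases h2 : φ = (InfinitePlace.mk φ).embedding
    · rw [if_neg h1, if_neg h1, if_pos h2, if_pos h2, Pi.smul_apply, smul_eq_mul]
    · rw [if_neg h1, if_neg h1, if_neg h2, if_neg h2, Pi.smul_apply, smul_eq_mul]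

omit [NumberField K] in
/-- The exponents of the type `(-1, -1_{ℂ})` of the norm character are all `-1`. [folklore] -/
theorem embExponent_normType [DecidablePred fun w : InfinitePlace K => w.IsReal] (φ : K →+* ℂ) :
    embExponent (fun _ => (-1 : ℤ)) (fun w => if w.IsReal then 0 else -1) φ = -1 := by
  unfold embExponent
  dsimp only
  by_cases hφ : ComplexEmbedding.IsReal φ
  · have hw : (InfinitePlace.mk φ).IsReal := ⟨φ, hφ, rfl⟩
    rw [if_pos hφ, if_pos hw, add_zero]
  · have hw : ¬ (InfinitePlace.mk φ).IsReal := by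
      rw [isReal_iff]
      rcases embedding_mk_eq φ with h | h
      · rwa [h]
      · rwa [h, ComplexEmbedding.isReal_conjugate_iff]
    by_cases he : φ = (InfinitePlace.mk φ).embedding
    · rw [if_neg hφ, if_pos he]
    · rw [if_neg hφ, if_neg he, if_neg hw]

omit [NumberField K] in
/-- **The exponents of the swapped type `(q, p)` are those of the conjugate embeddings**, for the type
`(p, q)` attached to an exponent function `n` on a totally complex field. [folklore] -/
theorem embExponent_typeOfExponent_swap [IsTotallyComplex K] (n : (K →+* ℂ) → ℤ) (φ : K →+* ℂ) :
    embExponent (typeOfExponent n).2 (typeOfExponent n).1 φ = n (ComplexEmbedding.conjugate φ) := by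
  unfold embExponent typeOfExponent
  dsimp only
  have hφ : ¬ ComplexEmbedding.IsReal φ := fun h =>
    (InfinitePlace.not_isReal_iff_isComplex.2 (IsTotallyComplex.isComplex (InfinitePlace.mk φ))) ⟨φ, h, rfl⟩
  have hw : ¬ (InfinitePlace.mk φ).IsReal :=
    InfinitePlace.not_isReal_iff_isComplex.2 (IsTotallyComplex.isComplex (InfinitePlace.mk φ))
  by_cases he : φ = (InfinitePlace.mk φ).embedding
  · rw [if_neg hφ, if_pos he, if_neg hw, ← he]
  · rw [if_neg hφ, if_neg he]
    rcases embedding_mk_eq φ with h | h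
    · exact absurd h.symm he
    · rw [h]

end Exponents

/-! ### §3b. The CM type of a CM type of places above `ℓ` -/

section CMType

variable {F₀ K : Type} [Field F₀] [Field K] [NumberField K] [Algebra F₀ K] {ℓ : ℕ} [Fact ℓ.Prime]

/-- **The place of `τ ∘ σ` is `σ⁻¹ • v_τ`** for `σ ∈ Aut(K/F₀)`. [folklore] -/
theorem place_comp_algEquiv (τ : K →+* PadicAlgCl ℓ) (σ : K ≃ₐ[F₀] K) :
    PadicEmbedding.place (τ.comp (σ : K →+* K)) = σ⁻¹ • PadicEmbedding.place τ := by
  refine HeightOneSpectrum.ext (Ideal.ext fun d => ?_)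
  rw [HeightOneSpectrum.smul_asIdeal, Ideal.mem_pointwise_smul_iff_inv_smul_mem, inv_inv]
  change d ∈ PadicEmbedding.ideal _ ↔ σ • d ∈ PadicEmbedding.ideal τ
  rw [PadicEmbedding.mem_ideal_iff, PadicEmbedding.mem_ideal_iff, RingHom.comp_apply]
  rfl

variable (Φ : Finset (HeightOneSpectrum (𝓞 K))) (ι : PadicAlgCl ℓ ≃+* ℂ)

open scoped Classical in
/-- **The exponent function of the CM type `T_Φ = {φ : K → ℂ | v_{ι⁻¹ ∘ φ} ∈ Φ}`** with value `m`:
`n(φ) = m` if the place above `ℓ` of the `ℓ`-adic embedding `ι⁻¹ ∘ φ` lies in `Φ`, else `0`. [folklore] -/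
def cmExponent (m : ℤ) (φ : K →+* ℂ) : ℤ :=
  if PadicEmbedding.place ((ι.symm : ℂ ≃+* PadicAlgCl ℓ).toRingHom.comp φ) ∈ Φ then m else 0

/-- Unfolding of `cmExponent` off `T_Φ`. [folklore] -/
theorem cmExponent_of_not_mem {m : ℤ} {φ : K →+* ℂ}
    (h : PadicEmbedding.place ((ι.symm : ℂ ≃+* PadicAlgCl ℓ).toRingHom.comp φ) ∉ Φ) : cmExponent Φ ι m φ = 0 := by
  classical
  unfold cmExponent; rw [if_neg h]

/-- Unfolding of `cmExponent` on `T_Φ`. [folklore] -/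
theorem cmExponent_of_mem {m : ℤ} {φ : K →+* ℂ}
    (h : PadicEmbedding.place ((ι.symm : ℂ ≃+* PadicAlgCl ℓ).toRingHom.comp φ) ∈ Φ) : cmExponent Φ ι m φ = m := by
  classical
  unfold cmExponent; rw [if_pos h]

/-- `cmExponent` takes only the values `0` and `m`. [folklore] -/
theorem cmExponent_eq_zero_or (m : ℤ) (φ : K →+* ℂ) : cmExponent Φ ι m φ = 0 ∨ cmExponent Φ ι m φ = m := by
  classical
  unfold cmExponent; split_ifs <;> simp

/-- **The exponent at a local embedding**: for a continuous `e : K_v → ℚ̄_ℓ`, the complex embedding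
`ι ∘ e ∘ ι_v` has exponent `m` if `v ∈ Φ` and `0` otherwise (`v_{e ∘ ι_v} = v`). [folklore] -/
theorem cmExponent_local [DecidableEq (HeightOneSpectrum (𝓞 K))] (m : ℤ) {v : HeightOneSpectrum (𝓞 K)}
    (e : v.adicCompletion K →+* PadicAlgCl ℓ) (he : Continuous e) :
    cmExponent Φ ι m ((ι : PadicAlgCl ℓ ≃+* ℂ).toRingHom.comp (e.comp (algebraMap K (v.adicCompletion K)))) =
      if v ∈ Φ then m else 0 := by
  classical
  have hcomp : (ι.symm : ℂ ≃+* PadicAlgCl ℓ).toRingHom.comp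
      ((ι : PadicAlgCl ℓ ≃+* ℂ).toRingHom.comp (e.comp (algebraMap K (v.adicCompletion K)))) =
      e.comp (algebraMap K (v.adicCompletion K)) := by
    ext x; simp
  unfold cmExponent
  rw [hcomp, PadicEmbedding.place_comp_algebraMap e he]
  by_cases hv : v ∈ Φ
  · rw [if_pos hv, if_pos hv]
  · rw [if_neg hv, if_neg hv]

variable [IsCMField K]

/-- **`T_Φ` is a CM type** when `Φ` meets every pair `{w, c • w}` of places above `ℓ` in exactly
one place: `n(φ) + n(\bar φ) = m` for every embedding `φ` (the `ℓ`-adic place of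
`ι⁻¹ ∘ \bar φ = (ι⁻¹ ∘ φ) ∘ c` is `c • v_{ι⁻¹ ∘ φ}`). [folklore] -/
theorem cmExponent_add_cmExponent_conjugate
    (hΦ : ∀ w : HeightOneSpectrum (𝓞 K), ((ℓ : ℕ) : 𝓞 K) ∈ w.asIdeal →
      (w ∈ Φ ↔ IsCMField.complexConj K • w ∉ Φ))
    (m : ℤ) (φ : K →+* ℂ) :
    cmExponent Φ ι m φ + cmExponent Φ ι m (ComplexEmbedding.conjugate φ) = m := by
  classical
  set τ : K →+* PadicAlgCl ℓ := (ι.symm : ℂ ≃+* PadicAlgCl ℓ).toRingHom.comp φ with hτ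
  have hconj : (ι.symm : ℂ ≃+* PadicAlgCl ℓ).toRingHom.comp (ComplexEmbedding.conjugate φ) =
      τ.comp ((IsCMField.complexConj K : K ≃ₐ[maximalRealSubfield K] K) : K →+* K) := by
    ext x
    change (ι.symm : ℂ ≃+* PadicAlgCl ℓ) (ComplexEmbedding.conjugate φ x) =
      (ι.symm : ℂ ≃+* PadicAlgCl ℓ) (φ (IsCMField.complexConj K x))
    rw [ComplexEmbedding.conjugate_coe_eq, IsCMField.complexEmbedding_complexConj]
  have hplace : PadicEmbedding.place ((ι.symm : ℂ ≃+* PadicAlgCl ℓ).toRingHom.comp (ComplexEmbedding.conjugate φ)) =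
      IsCMField.complexConj K • PadicEmbedding.place τ := by
    rw [hconj, place_comp_algEquiv, complexConj_inv]
  have hℓ : ((ℓ : ℕ) : 𝓞 K) ∈ (PadicEmbedding.place τ).asIdeal := PadicEmbedding.natCast_mem_place τ
  have key := hΦ (PadicEmbedding.place τ) hℓ
  unfold cmExponent
  rw [← hτ, hplace]
  by_cases h : PadicEmbedding.place τ ∈ Φ
  · rw [if_pos h, if_neg (key.1 h), add_zero]
  · have h' : IsCMField.complexConj K • PadicEmbedding.place τ ∈ Φ := by
      by_contra h'; exact h (key.2 h')
    rw [if_neg h, if_pos h', zero_add]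

end CMType

/-! ### §4. Existence of an algebraic Hecke character of CM type `-2k · 1_{T_Φ}`, unramified above `ℓ` -/

section Existence

variable {K : Type} [Field K] [NumberField K]

/-- A number field has infinitely many finite places (a prime above every rational prime); local
copy of `SorensenPatching.infinite_heightOneSpectrum` to keep the imports light. [folklore] -/
theorem infinite_heightOneSpectrum'' (F : Type*) [Field F] [NumberField F] : Infinite (HeightOneSpectrum (𝓞 F)) := by
  classical
  have hinj : Function.Injective (algebraMap ℤ (𝓞 F)) := (algebraMap ℤ (𝓞 F)).injective_int
  have key : ∀ p : Nat.Primes, ∃ w : HeightOneSpectrum (𝓞 F),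
      w.asIdeal.comap (algebraMap ℤ (𝓞 F)) = Ideal.span {(p : ℤ)} := by
    intro p
    have hp : Prime (p : ℤ) := Nat.prime_iff_prime_int.mp p.2
    haveI : (Ideal.span {(p : ℤ)}).IsPrime := (Ideal.span_singleton_prime hp.ne_zero).mpr hp
    obtain ⟨Q, -, hQ, hQp⟩ := Ideal.exists_ideal_over_prime_of_isIntegral
      (S := 𝓞 F) (Ideal.span {(p : ℤ)}) ⊥
      (by
        rw [← RingHom.ker_eq_comap_bot, (RingHom.injective_iff_ker_eq_bot _).mp hinj]
        exact bot_le)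
    refine ⟨⟨Q, hQ, fun hQbot => hp.ne_zero ?_⟩, hQp⟩
    have hmem : (p : ℤ) ∈ Q.comap (algebraMap ℤ (𝓞 F)) := by
      rw [hQp]
      exact Ideal.mem_span_singleton_self _
    rw [hQbot, Ideal.mem_comap, Ideal.mem_bot, map_eq_zero_iff _ hinj] at hmem
    exact hmem
  choose f hf using key
  refine Infinite.of_injective f fun p q hpq => ?_
  have h := hf p
  rw [hpq, hf q, Ideal.span_singleton_eq_span_singleton, Int.associated_iff_natAbs,
    Int.natAbs_natCast, Int.natAbs_natCast] at h
  exact Subtype.ext h.symm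

/-- The set of places containing a given nonzero integer is finite. [folklore] -/
theorem finite_setOf_mem_asIdeal {x : 𝓞 K} (hx : x ≠ 0) :
    {v : HeightOneSpectrum (𝓞 K) | x ∈ v.asIdeal}.Finite := by
  have h := Ideal.finite_factors (I := Ideal.span {x}) (by rwa [Ne, Ideal.zero_eq_bot, Ideal.span_singleton_eq_bot])
  refine h.subset fun v hv => ?_
  exact Ideal.dvd_span_singleton.2 hv

/-- **An auxiliary prime**: a finite place `v₀ ∤ ℓ` modulo which no nontrivial root of unity of `K` is
`≡ 1` (there are finitely many roots of unity and each `ζ - 1 ≠ 0` lies in finitely many primes).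
[folklore] -/
theorem exists_place_separating_torsion (ℓ : ℕ) (hℓ : ℓ ≠ 0) :
    ∃ v₀ : HeightOneSpectrum (𝓞 K), ((ℓ : ℕ) : 𝓞 K) ∉ v₀.asIdeal ∧
      ∀ ζ : Units.torsion K, ζ ≠ 1 → ((ζ : (𝓞 K)ˣ) : 𝓞 K) - 1 ∉ v₀.asIdeal := by
  classical
  haveI := infinite_heightOneSpectrum'' K
  have hℓ0 : ((ℓ : ℕ) : 𝓞 K) ≠ 0 := Nat.cast_ne_zero.2 hℓ
  have hζ0 : ∀ ζ : Units.torsion K, ζ ≠ 1 → ((ζ : (𝓞 K)ˣ) : 𝓞 K) - 1 ≠ 0 := by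
    intro ζ hζ h
    apply hζ
    have : ((ζ : (𝓞 K)ˣ) : 𝓞 K) = 1 := sub_eq_zero.1 h
    exact Subtype.ext (Units.val_eq_one.1 this)
  set B : Set (HeightOneSpectrum (𝓞 K)) := {v | ((ℓ : ℕ) : 𝓞 K) ∈ v.asIdeal} ∪
    ⋃ ζ : {ζ : Units.torsion K // ζ ≠ 1}, {v | ((ζ.1 : (𝓞 K)ˣ) : 𝓞 K) - 1 ∈ v.asIdeal} with hB
  have hBfin : B.Finite := by
    refine (finite_setOf_mem_asIdeal hℓ0).union (Set.finite_iUnion fun ζ => ?_)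
    exact finite_setOf_mem_asIdeal (hζ0 ζ.1 ζ.2)
  obtain ⟨v₀, hv₀⟩ := Infinite.exists_notMem_finset hBfin.toFinset
  rw [Set.Finite.mem_toFinset] at hv₀
  refine ⟨v₀, fun h => hv₀ (Or.inl h), fun ζ hζ h => hv₀ (Or.inr ?_)⟩
  exact Set.mem_iUnion.2 ⟨⟨ζ, hζ⟩, h⟩

/-- The infinite part of a local idele is `1`. [folklore] -/
theorem infPart_localUnits' (v : HeightOneSpectrum (𝓞 K)) (z : (v.adicCompletion K)ˣ) :
    infPart K (localUnits v z) = 1 :=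
  Units.ext (localUnits_fst v z)

/-- A local idele of valuation `1` is a unit idele. [folklore] -/
theorem localUnits_mem_unitIdeles {v : HeightOneSpectrum (𝓞 K)} {z : (v.adicCompletion K)ˣ}
    (hz : Valued.v (z : v.adicCompletion K) = 1) : localUnits v z ∈ unitIdeles K := by
  intro w
  by_cases hw : w = v
  · subst hw; rw [localUnits_snd_apply_self]; exact hz
  · rw [localUnits_snd_apply_of_ne z hw, map_one]

/-- **Weil's extension lemma, with the finite-level conclusion kept** (cf.
`HeckeCharacter.exists_isUnitary_infiniteIdeles_eq`, whose statement forgets it): for a continuous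
unitary `Φ : (K ⊗ ℝ)ˣ → ℂˣ` killing the global units `u ≡ 1 mod 𝔞` there is a unitary Hecke character
`ψ` with `ψ((x,1)) = Φ(x)` AND `ψ(z) = Φ(z_∞)` on the congruence unit ideles `W_𝔞 ∩ 𝕌_K`; in
particular `ψ` is unramified at every `v ∤ 𝔞`.  Weil 1956, §1. [cite: Weil1956, §1] -/
theorem exists_isUnitary_infiniteIdeles_eq_unramified (Φ : (InfiniteAdeleRing K)ˣ →ₜ* ℂˣ)
    (hΦ : ∀ x, ‖(Φ x : ℂ)‖ = 1) {𝔞 : Ideal (𝓞 K)} (h𝔞 : 𝔞 ≠ ⊥)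
    (hker : ∀ u : (𝓞 K)ˣ, (u : 𝓞 K) - 1 ∈ 𝔞 →
      Φ (globalToInfiniteUnits K (Units.map (algebraMap (𝓞 K) K : 𝓞 K →* K) u)) = 1) :
    ∃ ψ : HeckeCharacter K, ψ.IsUnitary ∧ (∀ x : (InfiniteAdeleRing K)ˣ, ψ (infiniteIdeles K x) = Φ x) ∧
      ∀ v : HeightOneSpectrum (𝓞 K), ¬ 𝔞 ≤ v.asIdeal → ψ.IsUnramifiedAt v := by
  classical
  -- `Φ` with values in `S¹`
  let Φc : (InfiniteAdeleRing K)ˣ →* Circle :=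
    { toFun := fun x => ⟨(Φ x : ℂ), mem_sphere_zero_iff_norm.mpr (hΦ x)⟩
      map_one' := Circle.ext (by simp)
      map_mul' := fun x y => Circle.ext (by simp) }
  -- the subgroup `W = (K ⊗ ℝ)ˣ · (W_𝔞 ∩ 𝕌_K)` and the character `φ = Φ ∘ (·)_∞` on it
  set W : Subgroup (ideleGroup K) :=
    (congruenceIdeles 𝔞 ⊓ unitIdeles K) ⊔ (infiniteIdeles K).range with hWdef
  have hWmem : ∀ x ∈ W, x ∈ unitIdeles K ∧ ∀ v : HeightOneSpectrum (𝓞 K), modulusExp 𝔞 v ≠ 0 →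
      Valued.v ((x : AdeleRing (𝓞 K) K).2 v - 1) ≤ WithZero.exp (-(modulusExp 𝔞 v : ℤ)) := by
    intro x hx
    obtain ⟨y, ⟨hyc, hyu⟩, z, ⟨t, rfl⟩, rfl⟩ := Subgroup.mem_sup.mp hx
    have hsu : infiniteIdeles K t ∈ unitIdeles K := fun v => by
      rw [infiniteIdeles_snd]; exact map_one _
    refine ⟨(unitIdeles K).mul_mem hyu hsu, fun v hv => ?_⟩
    rw [ideleGroup_val_snd_mul, infiniteIdeles_snd, mul_one]
    exact hyc.1 v hv
  have hWnhds : (W : Set (ideleGroup K)) ∈ nhds (1 : ideleGroup K) := by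
    refine Filter.mem_of_superset (Filter.inter_mem (congruenceIdeles_mem_nhds_one h𝔞)
      ((isOpen_unitIdeles K).mem_nhds (unitIdeles K).one_mem)) fun x hx => ?_
    exact Subgroup.mem_sup_left ⟨hx.1, hx.2⟩
  let φ : W →* Circle := (Φc.comp (infPart K)).comp W.subtype
  have hφ : ∀ w : W, (w : ideleGroup K) ∈ principalIdeles K → φ w = 1 := by
    rintro ⟨x, hx⟩ ⟨k, hk⟩
    obtain ⟨hxu, hxc⟩ := hWmem x hx
    have hk' : principalIdele K k = x := hk
    rw [← hk'] at hxu hxc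
    obtain ⟨u, huk, hu⟩ := exists_units_sub_one_mem_of_principalIdele h𝔞 hxu hxc
    apply Circle.ext
    change (Φ (infPart K x) : ℂ) = 1
    rw [← hk', infPart_principalIdele, ← huk, hker u hu, Units.val_one]
  obtain ⟨Ψ, hΨP, hΨW⟩ := Subgroup.exists_monoidHom_extension_eq_one Circle.exists_pow_eq
    (principalIdeles K) W φ hφ
  let ψ₀ : ideleGroup K →* ℂˣ := Circle.toUnits.comp Ψ
  have hψ₀W : ∀ x ∈ W, ψ₀ x = Φ (infPart K x) := fun x hx => by
    apply Units.ext
    change (((Ψ x : Circle) : ℂ)) = (Φ (infPart K x) : ℂ)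
    rw [show x = ((⟨x, hx⟩ : W) : ideleGroup K) from rfl, hΨW]
    rfl
  have hcont : Continuous ψ₀ := by
    refine continuous_of_continuousAt_one ψ₀ ?_
    have hc : Continuous fun x : ideleGroup K => Φ (infPart K x) :=
      Φ.continuous.comp continuous_infPart
    refine (hc.continuousAt.congr ?_)
    exact Filter.eventuallyEq_of_mem hWnhds fun x hx => (hψ₀W x hx).symm
  let ψ : HeckeCharacter K := ⟨⟨ψ₀, hcont⟩, fun x hx => by
    change Circle.toUnits (Ψ x) = 1
    rw [hΨP x hx, map_one]⟩
  have hψ : ∀ x, ψ x = ψ₀ x := fun x => rfl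
  refine ⟨ψ, fun x => ?_, fun x => ?_, fun v hv => ?_⟩
  · rw [hψ]
    exact Circle.norm_coe (Ψ x)
  · rw [hψ, hψ₀W _ (Subgroup.mem_sup_right ⟨x, rfl⟩), infPart_infiniteIdeles]
  · rw [isUnramifiedAt_iff_forall_valued_eq_one]
    intro z hz
    rw [hψ, hψ₀W _ (Subgroup.mem_sup_left ⟨localUnits_mem_congruenceIdeles h𝔞 hv z, localUnits_mem_unitIdeles hz⟩),
      infPart_localUnits', map_one]

/-- **The complex identity behind the CM infinity type**: for `z ≠ 0` and `a + b = -2k`,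
`(z/|z|)^{b-a} · (|z|²)^k = z^{-a} \bar z^{-b}`. [folklore] -/
theorem archUnitaryValue_mul_normSq_zpow {z : ℂ} (hz : z ≠ 0) {a b k : ℤ} (hab : a + b = -2 * k) :
    archUnitaryValue (b - a) 0 z * (((‖z‖ ^ 2 : ℝ)) : ℂ) ^ k = z ^ (-a) * (starRingEnd ℂ z) ^ (-b) := by
  have hr : ((‖z‖ : ℝ) : ℂ) ≠ 0 := Complex.ofReal_ne_zero.2 (norm_ne_zero_iff.2 hz)
  have hconj : starRingEnd ℂ z = ((‖z‖ : ℝ) : ℂ) ^ (2 : ℤ) * z⁻¹ := by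
    rw [zpow_ofNat, ← Complex.mul_conj', mul_comm z, mul_assoc, mul_inv_cancel₀ hz, mul_one]
  unfold archUnitaryValue
  rw [Complex.ofReal_zero, zero_mul, Complex.cpow_zero, mul_one, hconj, Complex.ofReal_pow,
    ← zpow_natCast ((‖z‖ : ℝ) : ℂ) 2, ← zpow_mul, mul_zpow, ← zpow_mul, inv_zpow', div_zpow,
    div_eq_mul_inv, ← zpow_neg]
  push_cast
  rw [show -(b - a) = a - b by ring, show (2 : ℤ) * k = -(a + b) by omega, show (2 : ℤ) * -b = -b + -b by ring,
    mul_assoc, ← zpow_add₀ hr, show a - b + -(a + b) = -b + -b by ring, neg_neg,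
    mul_comm (_ ^ (-b + -b)) (z ^ b), ← mul_assoc, ← zpow_add₀ hz, show -a + b = b - a by ring]

variable [IsCMField K]

/-- `c • 𝔞 = 𝔞` for `𝔞 = 𝔭 · c𝔭`. [folklore] -/
theorem complexConj_smul_mul_smul (I : Ideal (𝓞 K)) :
    IsCMField.complexConj K • (I * IsCMField.complexConj K • I) = I * IsCMField.complexConj K • I := by
  rw [smul_mul', smul_smul, complexConj_mul_self, one_smul, mul_comm]

/-- **The unit obstruction vanishes** (Kronecker + CM): if the exponents `m_w` are all even and the
prime `𝔭` separates the roots of unity, then `∏_w (σ_w u/|σ_w u|)^{m_w} = 1` for every global unit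
`u ≡ 1 (mod 𝔭 · c𝔭)` — for then `c u ≡ 1` too, the root of unity `u / c u` is `≡ 1 (mod 𝔭)`, hence
`= 1`, so every `σ_w u` is real.  (CHT 2008 Lemma 4.1.4: "the image … is generated by elements
`(-1)_{v₁} (-1)_{v₂}`".) [cite: ClozelHarrisTaylor2008, Lemma 4.1.4] -/
theorem prod_archUnitaryValue_unit_eq_one {v₀ : HeightOneSpectrum (𝓞 K)}
    (hv₀ : ∀ ζ : Units.torsion K, ζ ≠ 1 → ((ζ : (𝓞 K)ˣ) : 𝓞 K) - 1 ∉ v₀.asIdeal)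
    (mT : InfinitePlace K → ℤ) (hmT : ∀ w, Even (mT w)) (u : (𝓞 K)ˣ)
    (hu : (u : 𝓞 K) - 1 ∈ v₀.asIdeal * IsCMField.complexConj K • v₀.asIdeal) :
    ∏ w : InfinitePlace K, archUnitaryValue (mT w) 0 (w.embedding ((u : 𝓞 K) : K)) = 1 := by
  set c := IsCMField.complexConj K with hc
  set 𝔞 : Ideal (𝓞 K) := v₀.asIdeal * c • v₀.asIdeal with h𝔞
  -- `c u ≡ 1 (mod 𝔞)`
  have hcu : c • (u : 𝓞 K) - 1 ∈ 𝔞 := by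
    have : c • ((u : 𝓞 K) - 1) ∈ c • 𝔞 := Ideal.smul_mem_pointwise_smul_iff.2 hu
    rwa [h𝔞, complexConj_smul_mul_smul, ← h𝔞, smul_sub, smul_one] at this
  -- the unit `w = c u` and `ζ = u w⁻¹ ∈ μ(K)`
  set wu : (𝓞 K)ˣ := IsCMField.unitsComplexConj K u with hwu
  have hwu_val : ((wu : (𝓞 K)ˣ) : 𝓞 K) = c • (u : 𝓞 K) := by
    apply RingOfIntegers.ext
    rfl
  set ζ : Units.torsion K := IsCMField.unitsMulComplexConjInv K u with hζ
  have hζval : ((ζ : (𝓞 K)ˣ) : 𝓞 K) = (u : 𝓞 K) * (((wu⁻¹ : (𝓞 K)ˣ)) : 𝓞 K) := by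
    rw [hζ, IsCMField.unitsMulComplexConjInv_apply, Units.val_mul]
  have hζ1 : ((ζ : (𝓞 K)ˣ) : 𝓞 K) - 1 ∈ v₀.asIdeal := by
    have hid : ((ζ : (𝓞 K)ˣ) : 𝓞 K) - 1 = (((u : 𝓞 K) - 1) - (((wu : (𝓞 K)ˣ) : 𝓞 K) - 1)) * (((wu⁻¹ : (𝓞 K)ˣ)) : 𝓞 K) := by
      rw [hζval, sub_sub_sub_cancel_right, sub_mul, Units.mul_inv]
    rw [hid]
    refine Ideal.mul_le_right (I := v₀.asIdeal) (J := c • v₀.asIdeal) (Ideal.mul_mem_right _ _ (Ideal.sub_mem _ hu ?_))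
    rw [hwu_val]; exact hcu
  have hζone : ζ = 1 := by
    by_contra h
    exact hv₀ ζ h hζ1
  -- hence `u = c u`
  have hureal : (u : 𝓞 K) = c • (u : 𝓞 K) := by
    have h1 : ((ζ : (𝓞 K)ˣ) : 𝓞 K) = 1 := by rw [hζone]; rfl
    rw [hζval, ← Units.val_mul, Units.val_eq_one, mul_inv_eq_one] at h1
    rw [← hwu_val, h1]
  -- so every `σ_w u` is real and `(σ_w u/|σ_w u|)^{m_w} = 1`
  refine Finset.prod_eq_one fun w _ => ?_
  set z : ℂ := w.embedding ((u : 𝓞 K) : K) with hz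
  have hz0 : z ≠ 0 := by
    rw [hz, map_ne_zero]
    exact_mod_cast u.ne_zero
  have hzreal : starRingEnd ℂ z = z := by
    rw [hz, ← IsCMField.complexEmbedding_complexConj K w.embedding]
    change w.embedding (((c • (u : 𝓞 K) : 𝓞 K)) : K) = w.embedding ((u : 𝓞 K) : K)
    rw [← hureal]
  have hsq : (z / (‖z‖ : ℂ)) ^ (2 : ℤ) = 1 := by
    have hnn : ((‖z‖ : ℂ)) ^ 2 = z * z := by rw [← Complex.mul_conj', hzreal]
    have hn0 : ((‖z‖ : ℂ)) ≠ 0 := Complex.ofReal_ne_zero.2 (norm_ne_zero_iff.2 hz0)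
    rw [zpow_ofNat, div_pow, hnn, sq, div_self (mul_ne_zero hz0 hz0)]
  obtain ⟨t, ht⟩ := hmT w
  unfold archUnitaryValue
  rw [Complex.ofReal_zero, zero_mul, Complex.cpow_zero, mul_one, ht, ← two_mul, zpow_mul, hsq, one_zpow]

omit [IsCMField K] in
/-- The norm character is unramified everywhere. [folklore] -/
theorem isUnramifiedAt_normCharacter' (v : HeightOneSpectrum (𝓞 K)) : (normCharacter K).IsUnramifiedAt v :=
  IsNormTwist.isUnramifiedAt_holds (isNormTwist_normCharacter K) v

omit [IsCMField K] in
/-- `‖ϖ_v‖_v = N(v)⁻¹` (cf. `HeckeLFunctionNonvanishingLineProofs.norm_uniformizer`). [folklore] -/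
theorem norm_uniformizer' (v : HeightOneSpectrum (𝓞 K)) :
    ‖(uniformizer K v : v.adicCompletion K)‖ = (((Ideal.absNorm v.asIdeal : ℕ) : ℝ))⁻¹ := by
  rw [NumberField.FinitePlace.norm_def, valued_uniformizer, WithZero.exp,
    WithZeroMulInt.toNNReal_neg_apply _ WithZero.coe_ne_zero, WithZero.unzero_coe, toAdd_ofAdd,
    zpow_neg, zpow_one, NNReal.coe_inv, NNReal.coe_natCast]

omit [IsCMField K] in
/-- **`‖·‖(ϖ_v) = N(v)⁻¹`** (cf. `valueAtUniformizer_normCharacter`). [cite: TateThesis1967, §4.3] -/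
theorem valueAtUniformizer_normCharacter' (v : HeightOneSpectrum (𝓞 K)) :
    (normCharacter K).valueAtUniformizer v = (((Ideal.absNorm v.asIdeal : ℕ) : ℂ))⁻¹ := by
  rw [valueAtUniformizer, localComponent_apply, normCharacter_apply, ideleNorm_localUnits, norm_uniformizer',
    Complex.ofReal_inv, Complex.ofReal_natCast]

omit [NumberField K] [IsCMField K] in
/-- `σ • (natural number) = itself` in `𝓞 K`. [folklore] -/
theorem complexConj_smul_natCast (σ : K ≃ₐ[maximalRealSubfield K] K) (n : ℕ) : σ • ((n : ℕ) : 𝓞 K) = n :=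
  map_natCast (MulSemiringAction.toRingHom (K ≃ₐ[maximalRealSubfield K] K) (𝓞 K) σ) n

/-- **Existence of an algebraic Hecke character of CM type `-2k · 1_{T_Φ}`, unramified away from two
auxiliary conjugate primes `𝔭, c𝔭 ∤ ℓ`** (Weil 1956 §1; CHT 2008 Lemmas 4.1.1, 4.1.4): the unitary
`χ₀` of `exists_isUnitary_infiniteIdeles_eq_unramified` for the exponents `m_w = n(\bar σ_w) - n(σ_w)`
(even) and `𝔞 = 𝔭 · c𝔭` (`prod_archUnitaryValue_unit_eq_one`), twisted by `‖·‖^k`: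
`(u/|u|)^{b-a} (|u|²)^k = u^{-a} \bar u^{-b}` with `a + b = -2k` (`T_Φ` is a CM type).
[cite: ClozelHarrisTaylor2008, Lemma 4.1.4] [cite: Weil1956, §1] -/
theorem exists_hasInfinityType_cmType {ℓ : ℕ} [Fact ℓ.Prime] (Φ : Finset (HeightOneSpectrum (𝓞 K)))
    (ι : PadicAlgCl ℓ ≃+* ℂ)
    (hΦ : ∀ w : HeightOneSpectrum (𝓞 K), ((ℓ : ℕ) : 𝓞 K) ∈ w.asIdeal →
      (w ∈ Φ ↔ IsCMField.complexConj K • w ∉ Φ)) (k : ℤ) :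
    ∃ (χ : HeckeCharacter K) (S : Finset (HeightOneSpectrum (𝓞 K))),
      χ.HasInfinityType (typeOfExponent (cmExponent Φ ι (-2 * k))).1 (typeOfExponent (cmExponent Φ ι (-2 * k))).2 ∧
      (∀ v, v ∉ S → χ.IsUnramifiedAt v) ∧ (∀ v ∈ S, ((ℓ : ℕ) : 𝓞 K) ∉ v.asIdeal) ∧
      ∀ v ∈ S, IsCMField.complexConj K • v ∈ S := by
  classical
  set c := IsCMField.complexConj K with hc
  set m : ℤ := -2 * k with hm
  set n : (K →+* ℂ) → ℤ := cmExponent Φ ι m with hn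
  obtain ⟨v₀, hv₀ℓ, hv₀⟩ := exists_place_separating_torsion (K := K) ℓ (Fact.out : ℓ.Prime).ne_zero
  set 𝔞 : Ideal (𝓞 K) := v₀.asIdeal * c • v₀.asIdeal with h𝔞
  have h𝔞0 : 𝔞 ≠ ⊥ := by
    rw [h𝔞, Ne, Ideal.mul_eq_bot, not_or]
    exact ⟨v₀.ne_bot, fun h => v₀.ne_bot ((Ideal.smul_eq_bot_iff c v₀.asIdeal).1 h)⟩
  -- exponents
  set mT : InfinitePlace K → ℤ := fun w => n (ComplexEmbedding.conjugate w.embedding) - n w.embedding with hmT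
  have hmeven : Even m := ⟨-k, by rw [hm]; ring⟩
  have hmTeven : ∀ w, Even (mT w) := by
    intro w
    simp only [hmT, hn]
    rcases cmExponent_eq_zero_or Φ ι m (ComplexEmbedding.conjugate w.embedding) with h1 | h1 <;>
    rcases cmExponent_eq_zero_or Φ ι m w.embedding with h2 | h2 <;>
    simp only [h1, h2, sub_zero, zero_sub, sub_self, Even.neg, hmeven, Even.zero]
  -- the archimedean character
  obtain ⟨Φi, hΦi⟩ := exists_continuousMonoidHom_archUnitaryValue (K := K) mT (fun _ => 0)
  have hΦ1 : ∀ x, ‖(Φi x : ℂ)‖ = 1 := fun x => by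
    rw [hΦi, norm_prod]
    exact Finset.prod_eq_one fun w _ => norm_archUnitaryValue (InfiniteIdele.extensionEmbedding_apply_ne_zero x w) _ _
  have hkerΦ : ∀ u : (𝓞 K)ˣ, (u : 𝓞 K) - 1 ∈ 𝔞 →
      Φi (globalToInfiniteUnits K (Units.map (algebraMap (𝓞 K) K : 𝓞 K →* K) u)) = 1 := by
    intro u hu
    apply Units.ext
    rw [hΦi, Units.val_one, ← prod_archUnitaryValue_unit_eq_one hv₀ mT hmTeven u hu]
    refine Finset.prod_congr rfl fun w _ => ?_
    rw [extensionEmbedding_globalToInfiniteUnits]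
    rfl
  obtain ⟨χ₀, -, hχ₀inf, hχ₀unr⟩ := exists_isUnitary_infiniteIdeles_eq_unramified Φi hΦ1 h𝔞0 hkerΦ
  refine ⟨χ₀ * normCharacter K ^ k, {v₀, c • v₀}, ?_, ?_, ?_, ?_⟩
  · -- infinity type
    refine ⟨Set.univ, Filter.univ_mem, fun x _ => ?_⟩
    rw [mul_apply, Units.val_mul, zpow_apply', Units.val_zpow_eq_zpow_val, hχ₀inf, hΦi, normCharacter_apply,
      ideleNorm_infiniteIdeles', Complex.ofReal_prod, ← Finset.prod_zpow, ← Finset.prod_mul_distrib, archFactor_apply]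
    refine Finset.prod_congr rfl fun w _ => ?_
    have hw : ¬ w.IsReal := InfinitePlace.not_isReal_iff_isComplex.2 (IsTotallyComplex.isComplex w)
    unfold typeOfExponent
    dsimp only
    rw [if_neg hw, NumberField.InfinitePlace.mult, if_neg hw,
      ← (isometry_extensionEmbedding w).norm_map_of_map_zero (map_zero _) ((x : InfiniteAdeleRing K) w)]
    exact archUnitaryValue_mul_normSq_zpow (InfiniteIdele.extensionEmbedding_apply_ne_zero x w)
      (cmExponent_add_cmExponent_conjugate Φ ι hΦ m w.embedding)
  · intro v hv
    rw [Finset.mem_insert, Finset.mem_singleton, not_or] at hv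
    refine (hχ₀unr v ?_).mul' ((isUnramifiedAt_normCharacter' v).zpow' k)
    intro hle
    rcases (Ideal.IsPrime.mul_le v.isPrime).1 hle with h | h
    · exact hv.1 (HeightOneSpectrum.ext (v₀.isMaximal.eq_of_le v.isPrime.ne_top h)).symm
    · exact hv.2 (HeightOneSpectrum.ext ((c • v₀).isMaximal.eq_of_le v.isPrime.ne_top h)).symm
  · intro v hv
    rw [Finset.mem_insert, Finset.mem_singleton] at hv
    rcases hv with rfl | rfl
    · exact hv₀ℓ
    · rw [HeightOneSpectrum.smul_asIdeal, Ideal.mem_pointwise_smul_iff_inv_smul_mem, complexConj_smul_natCast]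
      exact hv₀ℓ
  · intro v hv
    rw [Finset.mem_insert, Finset.mem_singleton] at hv ⊢
    rcases hv with rfl | rfl
    · exact Or.inr rfl
    · left
      rw [smul_smul]
      change (IsCMField.complexConj K * IsCMField.complexConj K) • v₀ = v₀
      rw [complexConj_mul_self, one_smul]

end Existence

/-! ### §5. The twist `Ξ = ‖·‖^{2k} χ (χ ∘ c)⁻¹` -/

section Twist

variable {K : Type} [Field K] [NumberField K] [IsCMField K]

/-- **The CM twist `Ξ = ‖·‖^{2k} · χ · (χ ∘ c)⁻¹`** of a Hecke character `χ` of a CM field. [folklore] -/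
def cmTwist (χ : HeckeCharacter K) (k : ℤ) : HeckeCharacter K :=
  normCharacter K ^ (2 * k) * χ * (galConj (IsCMField.complexConj K) χ)⁻¹

open scoped Classical in
/-- **Infinity type of the CM twist**: `(2k)(-1,-1_ℂ) + (p, q) - (q, p)`. [folklore] -/
theorem hasInfinityType_cmTwist {χ : HeckeCharacter K} {p q : InfinitePlace K → ℤ} (hχ : χ.HasInfinityType p q)
    (k : ℤ) :
    (cmTwist χ k).HasInfinityType
      ((2 * k) • (fun _ => (-1 : ℤ)) + p + -q)
      ((2 * k) • (fun w : InfinitePlace K => if w.IsReal then (0 : ℤ) else -1) + q + -p) :=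
  ((hasInfinityType_normCharacter'.zpow' (2 * k)).mul' hχ).mul' hχ.galConj_complexConj.inv

open scoped Classical in
/-- **The exponents of the CM twist are `2 n(φ)`** for `χ` of type `-2k · 1_{T_Φ}`: the norm part
contributes `-2k`, `χ` contributes `n(φ)`, `(χ ∘ c)⁻¹` contributes `-n(\bar φ) = n(φ) + 2k`. [folklore] -/
theorem embExponent_cmTwist {ℓ : ℕ} [Fact ℓ.Prime] (Φ : Finset (HeightOneSpectrum (𝓞 K))) (ι : PadicAlgCl ℓ ≃+* ℂ)
    (hΦ : ∀ w : HeightOneSpectrum (𝓞 K), ((ℓ : ℕ) : 𝓞 K) ∈ w.asIdeal →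
      (w ∈ Φ ↔ IsCMField.complexConj K • w ∉ Φ)) (k : ℤ) (φ : K →+* ℂ) :
    embExponent
      ((2 * k) • (fun _ => (-1 : ℤ)) + (typeOfExponent (cmExponent Φ ι (-2 * k))).1 +
        -(typeOfExponent (cmExponent Φ ι (-2 * k))).2)
      ((2 * k) • (fun w : InfinitePlace K => if w.IsReal then (0 : ℤ) else -1) +
        (typeOfExponent (cmExponent Φ ι (-2 * k))).2 + -(typeOfExponent (cmExponent Φ ι (-2 * k))).1) φ =
      2 * cmExponent Φ ι (-2 * k) φ := by
  rw [embExponent_add, embExponent_add, embExponent_zsmul, embExponent_normType, embExponent_typeOfExponent,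
    embExponent_neg, embExponent_typeOfExponent_swap]
  have := cmExponent_add_cmExponent_conjugate Φ ι hΦ (-2 * k) φ
  linarith

open scoped Classical in
/-- **Exponents of the CM twist at the local embeddings**: `-4k` above `Φ`, `0` above `Φᶜ`. [folklore] -/
theorem embExponent_cmTwist_local {ℓ : ℕ} [Fact ℓ.Prime] (Φ : Finset (HeightOneSpectrum (𝓞 K))) (ι : PadicAlgCl ℓ ≃+* ℂ)
    (hΦ : ∀ w : HeightOneSpectrum (𝓞 K), ((ℓ : ℕ) : 𝓞 K) ∈ w.asIdeal →
      (w ∈ Φ ↔ IsCMField.complexConj K • w ∉ Φ)) (k : ℤ)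
    {v : HeightOneSpectrum (𝓞 K)} (e : v.adicCompletion K →+* PadicAlgCl ℓ) (he : Continuous e) :
    embExponent
      ((2 * k) • (fun _ => (-1 : ℤ)) + (typeOfExponent (cmExponent Φ ι (-2 * k))).1 +
        -(typeOfExponent (cmExponent Φ ι (-2 * k))).2)
      ((2 * k) • (fun w : InfinitePlace K => if w.IsReal then (0 : ℤ) else -1) +
        (typeOfExponent (cmExponent Φ ι (-2 * k))).2 + -(typeOfExponent (cmExponent Φ ι (-2 * k))).1)
      ((ι : PadicAlgCl ℓ ≃+* ℂ).toRingHom.comp (e.comp (algebraMap K (v.adicCompletion K)))) =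
      if v ∈ Φ then -4 * k else 0 := by
  rw [embExponent_cmTwist Φ ι hΦ, cmExponent_local Φ ι _ e he]
  by_cases hv : v ∈ Φ
  · rw [if_pos hv, if_pos hv]; ring
  · rw [if_neg hv, if_neg hv]; ring

/-- **The CM twist is unramified wherever `χ` is unramified at `v` and at `c • v`.** [folklore] -/
theorem isUnramifiedAt_cmTwist {χ : HeckeCharacter K} (k : ℤ) {v : HeightOneSpectrum (𝓞 K)}
    (hv : χ.IsUnramifiedAt v) (hcv : χ.IsUnramifiedAt (IsCMField.complexConj K • v)) :
    (cmTwist χ k).IsUnramifiedAt v := by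
  unfold cmTwist
  refine (((isUnramifiedAt_normCharacter' v).zpow' (2 * k)).mul' hv).mul' ?_
  exact ((isUnramifiedAt_galConj_iff _ χ v).2 hcv).inv'

/-- **Values of the CM twist: `Ξ(ϖ_v) Ξ(ϖ_{c v}) = N(v)^{-2k} N(c v)^{-2k}`** when `χ` is unramified at
`v` and `c • v` (the `χ`-parts cancel: `(χ ∘ c)(ϖ_v) = χ(ϖ_{c v})`, `(χ ∘ c)(ϖ_{c v}) = χ(ϖ_v)`). [folklore] -/
theorem valueAtUniformizer_cmTwist_mul {χ : HeckeCharacter K} (k : ℤ) {v : HeightOneSpectrum (𝓞 K)}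
    (hv : χ.IsUnramifiedAt v) (hcv : χ.IsUnramifiedAt (IsCMField.complexConj K • v)) :
    (cmTwist χ k).valueAtUniformizer v * (cmTwist χ k).valueAtUniformizer (IsCMField.complexConj K • v) =
      ((((Ideal.absNorm v.asIdeal : ℕ) : ℂ))⁻¹) ^ (2 * k) *
        ((((Ideal.absNorm (IsCMField.complexConj K • v).asIdeal : ℕ) : ℂ))⁻¹) ^ (2 * k) := by
  have hccv : IsCMField.complexConj K • (IsCMField.complexConj K • v) = v := by
    rw [smul_smul, complexConj_mul_self, one_smul]
  have hχ0 : χ.valueAtUniformizer v ≠ 0 := by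
    rw [valueAtUniformizer]; exact (χ.localComponent v (uniformizer K v)).ne_zero
  have hχ0' : χ.valueAtUniformizer (IsCMField.complexConj K • v) ≠ 0 := by
    rw [valueAtUniformizer]; exact (χ.localComponent _ (uniformizer K _)).ne_zero
  unfold cmTwist
  rw [valueAtUniformizer_mul', valueAtUniformizer_mul', valueAtUniformizer_mul', valueAtUniformizer_mul',
    valueAtUniformizer_inv', valueAtUniformizer_inv', valueAtUniformizer_zpow', valueAtUniformizer_zpow',
    valueAtUniformizer_normCharacter', valueAtUniformizer_normCharacter',
    valueAtUniformizer_galConj_of_isUnramifiedAt _ χ v hcv, valueAtUniformizer_galConj_of_isUnramifiedAt _ χ _ (by rw [hccv]; exact hv)]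
  simp only [hccv]
  field_simp

end Twist

end HeckeCharacter

end Literature.NumberTheory.GaloisRepresentations

end
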